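import Mathlib
import HarnessLib
import Summits.HubbardSuperconductivity.HubbardSuperconductivity.Theorems.KLProgrammeFermiSurfaceSharpAnalysisWindow
import Summits.HubbardSuperconductivity.HubbardSuperconductivity.Theorems.KLProgrammeFermiSurfaceBandConstants

/-!
# Route `KLProgramme` (K1 `H10TwoPointLimit`, K3 `KLRegimeTwoPointLimit`) — sharp band-curve envelopes, part 5:
# the EXACT radial transversality constant `∂ₜF ≥ 2 sin u_μ(θ) ≥ 2 s_*` (fs-1 g4's open item (a))

Cell `gate-hubbard-kl`, seat fs-1 (g5), risk r2 (serving r1 «explicit constants»). The `BandBounds` field `Dtmin ≤ ∂ₜF(θ, u)`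
(radial derivative of the band at the Fermi curve, the denominator of every perturbation threshold of the moving-curve count,
HOME/prover-p4/PORT-NOTE.md §3) was bounded in part 4 (`klfs_exists_sharpBandBounds`) by `max(√2 s_*, 2 (sin K_b/K_b) √2 d_a)`,
within a factor `1.31` of the truth. Here the truth: since `sin t / t` decreases on `(0, π]` and `|X|, |Y| ≤ u < π`,
`W = X sin X + Y sin Y ≥ (X² + Y²) sin u / u = u sin u`, hence **`∂ₜF = 2W/u ≥ 2 sin u_μ(θ)`** with equality at the antinodes
(`klfs_rayDispersionDt_ge_two_sin_radius`); on a level range `[a, b]` the radius lies in `[√2 d_a, K_b] ⊂ (0, π)` and `sin` is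
concave, so `∂ₜF ≥ 2 min(sin(√2 d_a), sin K_b)` (`klfs_rayDispersionDt_ge_range`), which on both programme windows is
`2 sin K_b = 2 s_b = √(-b(4+b))` (certified truth «min Dt = 2 sin K», kit j252652): **`∂ₜF ≥ 0.8286`** on the certified window
`[-0.4267, -0.1798]` (part 4: `0.628`) and **`∂ₜF ≥ 0.7599`** on the analysis window `[-1, -0.15]` (part 4/`…SharpAnalysisWindow`:
`0.537`) — these equal the Fermi-speed minima `v_F,min` of FS-WINDOW §1 (at the antinode `∇ε ∥ e_r`). No definitions; everything
PROVED. [folklore]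
-/

noncomputable section

open Real Set

-- the tree's namespace `Summit.<Summit>.<Problem>.Theorems` repeats the summit name by design (D-0017)
set_option linter.dupNamespace false

namespace Summit.HubbardSuperconductivity.HubbardSuperconductivity.Theorems

open Literature.MathematicalPhysics.QuantumLattice
open Literature.MathematicalPhysics.QuantumLattice.BandSectorCounting

/-- `sin t / t` is antitone on `(0, π]`: `sin y / y ≤ sin x / x` for `0 < x ≤ y ≤ π` (concavity of `sin`). [folklore] -/
theorem klfs_sinc_antitone {x y : ℝ} (hx : 0 < x) (hxy : x ≤ y) (hy : y ≤ π) :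
    Real.sin y / y ≤ Real.sin x / x := by
  have hy0 : 0 < y := hx.trans_le hxy
  rcases hxy.eq_or_lt with heq | hlt
  · rw [heq]
  have hconv : ConvexOn ℝ (Icc 0 π) (fun t => -Real.sin t) := (strictConcaveOn_sin_Icc.concaveOn).neg
  have h := hconv.secant_mono (a := 0) (x := x) (y := y) ⟨le_rfl, Real.pi_pos.le⟩
    ⟨hx.le, hxy.trans hy⟩ ⟨hy0.le, hy⟩ hx.ne' hy0.ne' hxy
  simp only [Real.sin_zero, neg_zero, sub_zero] at h
  rw [neg_div, neg_div] at h
  linarith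

/-- `x sin x ≥ x² · (sin u / u)` for `|x| ≤ u ≤ π`, `u > 0`. [folklore] -/
theorem klfs_mul_sin_ge_sq_mul_sinc {x u : ℝ} (huπ : u ≤ π) (hx : |x| ≤ u) :
    x ^ 2 * (Real.sin u / u) ≤ x * Real.sin x := by
  -- reduce to `x ≥ 0` (`x sin x` and `x²` are even)
  wlog h0 : 0 ≤ x generalizing x
  · have h := this (x := -x) (by rwa [abs_neg]) (by linarith [le_of_not_ge h0])
    simpa [Real.sin_neg] using h
  rcases h0.eq_or_lt with heq | hpos
  · rw [← heq]; simp
  rw [abs_of_nonneg h0] at hx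
  have hs := klfs_sinc_antitone hpos hx huπ
  have : x ^ 2 * (Real.sin u / u) ≤ x ^ 2 * (Real.sin x / x) := mul_le_mul_of_nonneg_left hs (sq_nonneg x)
  calc x ^ 2 * (Real.sin u / u) ≤ x ^ 2 * (Real.sin x / x) := this
    _ = x * Real.sin x := by field_simp

section Level

variable {μ : ℝ} (hμ₁ : -4 < μ) (hμ₂ : μ < 0)
include hμ₁ hμ₂

/-- `W = X sin X + Y sin Y ≥ u sin u` on the band curve. [folklore] -/
theorem klfs_W_ge_radius_mul_sin (θ : ℝ) :
    bandFermiRadius μ θ * Real.sin (bandFermiRadius μ θ) ≤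
      bandX μ θ * Real.sin (bandX μ θ) + bandY μ θ * Real.sin (bandY μ θ) := by
  have hu := bandFermiRadius_pos hμ₁ hμ₂ θ
  have huπ := (klfs_bandFermiRadius_lt_pi hμ₁ hμ₂ θ).le
  have hsq : bandX μ θ ^ 2 + bandY μ θ ^ 2 = bandFermiRadius μ θ ^ 2 := by
    simp only [bandX, bandY]
    nlinarith [Real.sin_sq_add_cos_sq θ]
  have hX : |bandX μ θ| ≤ bandFermiRadius μ θ := by
    simp only [bandX, abs_mul, abs_of_pos hu]
    exact mul_le_of_le_one_right hu.le (Real.abs_cos_le_one θ)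
  have hY : |bandY μ θ| ≤ bandFermiRadius μ θ := by
    simp only [bandY, abs_mul, abs_of_pos hu]
    exact mul_le_of_le_one_right hu.le (Real.abs_sin_le_one θ)
  have h1 := klfs_mul_sin_ge_sq_mul_sinc huπ hX
  have h2 := klfs_mul_sin_ge_sq_mul_sinc huπ hY
  have h3 : bandFermiRadius μ θ * Real.sin (bandFermiRadius μ θ) =
      (bandX μ θ ^ 2 + bandY μ θ ^ 2) * (Real.sin (bandFermiRadius μ θ) / bandFermiRadius μ θ) := by
    rw [hsq]; field_simp
  rw [h3, add_mul]
  exact add_le_add h1 h2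

/-- **`∂ₜF ≥ 2 sin u_μ(θ)`** — the exact radial transversality (equality at the antinodes, where `∇ε ∥ e_r` and
`∂ₜF = |∇ε| = 2 sin K_μ`). [folklore] -/
theorem klfs_rayDispersionDt_ge_two_sin_radius (θ : ℝ) :
    2 * Real.sin (bandFermiRadius μ θ) ≤ rayDispersionDt θ (bandFermiRadius μ θ) := by
  have hu := bandFermiRadius_pos hμ₁ hμ₂ θ
  have hW := klfs_W_ge_radius_mul_sin hμ₁ hμ₂ θ
  rw [klfs_W_eq hμ₁ hμ₂ θ] at hW
  rw [klfs_rayDispersionDt_eq hμ₁ hμ₂ θ]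
  -- `u sin u ≤ c u²` ⇒ `2 sin u ≤ 2 u c`
  have : Real.sin (bandFermiRadius μ θ) ≤ bandNormalCoeff μ θ * bandFermiRadius μ θ := by
    have h := div_le_div_of_nonneg_right hW hu.le
    rw [mul_comm, mul_div_assoc, div_self hu.ne', mul_one] at h
    calc Real.sin (bandFermiRadius μ θ) ≤ bandNormalCoeff μ θ * bandFermiRadius μ θ ^ 2 / bandFermiRadius μ θ := h
      _ = bandNormalCoeff μ θ * bandFermiRadius μ θ := by field_simp
  nlinarith

end Level

/-! ### Range form and the numbers on the two windows -/

section Range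

variable {a b : ℝ} (ha : -4 < a) (hab : a ≤ b) (hb : b < 0)
include ha hab hb

/-- On a level range `[a, b]`: `∂ₜF ≥ 2 min(sin(√2 d_a), sin K_b)` (the radius lies in `[√2 d_a, K_b] ⊂ (0, π)` and `sin` is
unimodal there). [folklore] -/
theorem klfs_rayDispersionDt_ge_range {μ : ℝ} (hμ : μ ∈ Icc a b) (θ : ℝ) :
    2 * min (Real.sin (Real.sqrt 2 * Real.arccos (-a / 4))) (Real.sin (umklappRadius b)) ≤
      rayDispersionDt θ (bandFermiRadius μ θ) := by
  have hμ₁ : -4 < μ := ha.trans_le hμ.1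
  have hμ₂ : μ < 0 := hμ.2.trans_lt hb
  have hπ := Real.pi_pos
  refine le_trans ?_ (klfs_rayDispersionDt_ge_two_sin_radius hμ₁ hμ₂ θ)
  refine mul_le_mul_of_nonneg_left ?_ (by norm_num)
  set u := bandFermiRadius μ θ with hu
  set p := Real.sqrt 2 * Real.arccos (-a / 4) with hp
  set q := umklappRadius b with hq
  have hpu : p ≤ u := by
    have h1 := klfs_sqrt_two_mul_arccos_le_bandFermiRadius hμ₁ hμ₂ θ
    have h2 := mul_le_mul_of_nonneg_left (klfs_arccos_quarter_mono (a := a) (b := b) hμ) (Real.sqrt_nonneg 2)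
    exact h2.trans h1
  have huq : u ≤ q := (klfs_bandFermiRadius_le_umklappRadius hμ₁ hμ₂ θ).trans (umklappRadius_mono hμ.2)
  have hqπ : q < π := umklappRadius_lt_pi hb
  have hp0 : 0 < p := mul_pos (Real.sqrt_pos.2 (by norm_num)) (klfs_arccos_quarter_pos_lt ha hab hb).1
  rcases le_or_gt u (π / 2) with hle | hgt
  · exact (min_le_left _ _).trans (Real.sin_le_sin_of_le_of_le_pi_div_two (by linarith) hle hpu)
  · refine (min_le_right _ _).trans ?_
    rw [← Real.sin_pi_sub q, ← Real.sin_pi_sub u]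
    exact Real.sin_le_sin_of_le_of_le_pi_div_two (by linarith) (by linarith) (by linarith)

omit ha hab hb in
/-- `sin(√2 d_a) ≥ 0.585` whenever `1.318 ≤ d_a ≤ 1.5708` (then `π - √2 d_a ∈ [0.92, 1.28] ⊂ [0, π/2]` and
`sin x ≥ (2/π) x`). [folklore] -/
theorem klfs_num_sin_sqrt_two_mul_ge {d : ℝ} (hd1 : 1.318 ≤ d) (hd2 : d ≤ 1.5708) :
    (0.585 : ℝ) ≤ Real.sin (Real.sqrt 2 * d) := by
  have hπ1 := Real.pi_gt_d6
  have hπ2 := Real.pi_lt_d6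
  obtain ⟨h2l, h2u⟩ := klfs_num_sqrt_two
  have hlo : (1.8639 : ℝ) ≤ Real.sqrt 2 * d := by nlinarith
  have hhi : Real.sqrt 2 * d ≤ 2.2215 := by nlinarith
  rw [← Real.sin_pi_sub]
  have hx0 : 0 ≤ π - Real.sqrt 2 * d := by linarith
  have hx1 : π - Real.sqrt 2 * d ≤ π / 2 := by linarith
  have h := Real.mul_le_sin hx0 hx1
  have hπ0 : 0 < π := Real.pi_pos
  have h3 : (0.585 : ℝ) ≤ 2 / π * (π - Real.sqrt 2 * d) := by
    rw [div_mul_eq_mul_div, le_div_iff₀ hπ0]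
    linarith
  linarith

omit ha hab hb in
/-- **The exact radial transversality constants on the two programme windows**: `∂ₜF ≥ 0.8286` for
`μ ∈ [-0.4267, -0.1798]` and `∂ₜF ≥ 0.7599` for `μ ∈ [-1, -0.15]` (both `= 2 s_b`; part 4 had `0.628` / `0.537`). [folklore] -/
theorem klfs_windows_rayDispersionDt_ge {μ : ℝ} (θ : ℝ) :
    (μ ∈ Icc (-0.4267 : ℝ) (-0.1798) → (0.8286 : ℝ) ≤ rayDispersionDt θ (bandFermiRadius μ θ)) ∧
    (μ ∈ Icc (-1 : ℝ) (-0.15) → (0.7599 : ℝ) ≤ rayDispersionDt θ (bandFermiRadius μ θ)) := by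
  constructor
  · intro hμ
    have h := klfs_rayDispersionDt_ge_range (a := -0.4267) (b := -0.1798) (by norm_num) (by norm_num) (by norm_num) hμ θ
    have hs : (0.4143 : ℝ) ≤ Real.sin (umklappRadius (-0.1798)) := by
      rw [klfs_sin_umklappRadius (by norm_num) (by norm_num), le_div_iff₀ (by norm_num : (0:ℝ) < 2),
        Real.le_sqrt (by norm_num) (by norm_num)]
      norm_num
    have hp : (0.585 : ℝ) ≤ Real.sin (Real.sqrt 2 * Real.arccos (-(-0.4267 : ℝ) / 4)) :=
      klfs_num_sin_sqrt_two_mul_ge (by linarith [klfs_num_arccos_da_ge]) klfs_num_arccos_da_le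
    have hmin : (0.4143 : ℝ) ≤ min (Real.sin (Real.sqrt 2 * Real.arccos (-(-0.4267 : ℝ) / 4)))
        (Real.sin (umklappRadius (-0.1798))) := le_min (by linarith) hs
    linarith
  · intro hμ
    have h := klfs_rayDispersionDt_ge_range (a := -1) (b := -0.15) (by norm_num) (by norm_num) (by norm_num) hμ θ
    have hs : (0.37995 : ℝ) ≤ Real.sin (umklappRadius (-0.15)) := by
      rw [klfs_sin_umklappRadius (by norm_num) (by norm_num), le_div_iff₀ (by norm_num : (0:ℝ) < 2),
        Real.le_sqrt (by norm_num) (by norm_num)]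
      norm_num
    have hp : (0.585 : ℝ) ≤ Real.sin (Real.sqrt 2 * Real.arccos (-(-1 : ℝ) / 4)) :=
      klfs_num_sin_sqrt_two_mul_ge klfs_numA_arccos_da_ge klfs_numA_arccos_da_le
    have hmin : (0.37995 : ℝ) ≤ min (Real.sin (Real.sqrt 2 * Real.arccos (-(-1 : ℝ) / 4)))
        (Real.sin (umklappRadius (-0.15))) := le_min (by linarith) hs
    linarith

end Range

/-! ### The window bundles with the exact transversality constant (appended, fs-1 g5) -/

/-- **The SHARP bundle on the certified window with the exact `Dt_min`**: a `BandBounds (-0.4267) (-0.1798)` with the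
numbers of `klfs_window_sharpBandBounds` and `Dtmin ≥ 0.8286` (was `0.628`), hence `Dcell ≤ 3.14` (was `3.52`). [folklore] -/
theorem klfs_window_sharpBandBounds_exactDt :
    ∃ B : BandBounds (-0.4267) (-0.1798),
      2.06 ≤ B.umin ∧ B.smax ≤ 3.85 ∧ B.A2 ≤ 33 ∧ 0.19 ≤ B.hmin ∧ 0.0656 ≤ B.amin ∧ 0.4143 ≤ B.rhomin ∧
      B.cmax ≤ 0.685 ∧ 0.8286 ≤ B.Dtmin ∧ B.Cg ≤ 96 ∧ B.Dcell ≤ 3.14 := by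
  obtain ⟨B₀, hu, hs, hA, hh, ham, hr, hc, -, hCg, -⟩ := klfs_window_sharpBandBounds
  have hDt : ∀ μ ∈ Icc (-0.4267 : ℝ) (-0.1798), ∀ θ : ℝ, (0.8286 : ℝ) ≤ rayDispersionDt θ (bandFermiRadius μ θ) :=
    fun μ hμ θ => (klfs_windows_rayDispersionDt_ge (μ := μ) θ).1 hμ
  refine ⟨{ B₀ with Dtmin := 0.8286, Dtmin_pos := by norm_num, Dt_ge := hDt }, hu, hs, hA, hh, ham, hr, hc, le_rfl, ?_, ?_⟩
  · exact hCg
  · show 1 / (0.8286 : ℝ) + B₀.smax / 2 ≤ 3.14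
    have : (1 : ℝ) / 0.8286 ≤ 1.207 := by norm_num
    linarith

/-- **The SHARP bundle on the analysis window with the exact `Dt_min`**: a `BandBounds (-1) (-0.15)` with the numbers of
`klfs_analysisWindow_sharpBandBounds` and `Dtmin ≥ 0.7599` (was `0.537`), hence `Dcell ≤ 3.28` (was `3.82`). [folklore] -/
theorem klfs_analysisWindow_sharpBandBounds_exactDt :
    ∃ B : BandBounds (-1) (-0.15),
      1.86 ≤ B.umin ∧ B.smax ≤ 3.91 ∧ B.A2 ≤ 36.2 ∧ 0.138 ≤ B.hmin ∧ 0.0494 ≤ B.amin ∧ 0.3799 ≤ B.rhomin ∧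
      B.cmax ≤ 0.735 ∧ 0.7599 ≤ B.Dtmin ∧ B.Cg ≤ 162 ∧ B.Dcell ≤ 3.28 := by
  obtain ⟨B₀, hu, hs, hA, hh, ham, hr, hc, -, hCg, -⟩ := klfs_analysisWindow_sharpBandBounds
  have hDt : ∀ μ ∈ Icc (-1 : ℝ) (-0.15), ∀ θ : ℝ, (0.7599 : ℝ) ≤ rayDispersionDt θ (bandFermiRadius μ θ) :=
    fun μ hμ θ => (klfs_windows_rayDispersionDt_ge (μ := μ) θ).2 hμ
  refine ⟨{ B₀ with Dtmin := 0.7599, Dtmin_pos := by norm_num, Dt_ge := hDt }, hu, hs, hA, hh, ham, hr, hc, le_rfl, ?_, ?_⟩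
  · exact hCg
  · show 1 / (0.7599 : ℝ) + B₀.smax / 2 ≤ 3.28
    have : (1 : ℝ) / 0.7599 ≤ 1.316 := by norm_num
    linarith

end Summit.HubbardSuperconductivity.HubbardSuperconductivity.Theorems

end
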